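import Mathlib.Analysis.Complex.ReImTopology
import Mathlib.Analysis.Complex.Convex
import Mathlib.Analysis.Convex.Topology
import Literature.Probability.LatticeModels.DomainDiscretisation
import Literature.Analysis.Complex.GridCauchyFormula
import HarnessLib

/-!
# Columns of the mesh `δℤ²`: grid lines, cells, rungs, and the crossing parity of lattice walks

Topic: Probability / LatticeModels (companion to `DomainDiscretisation.lean`; first file of the
"bulk = largest mesh component for every Jordan domain" theorem, `MeshDomainJordan.lean`).
Elementary bookkeeping of the square mesh of size `δ > 0` in `ℂ`:

* `gridLines δ` — the union of the lines `re z ∈ δℤ` and `im z ∈ δℤ`; mesh points and closed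
  mesh edges lie on it (`meshPoint_mem_gridLines`, `segment_meshPoint_subset_gridLines`), and a
  mesh point on a closed mesh edge is one of its two ends (`eq_or_eq_of_meshPoint_mem_segment`).
* `cell δ k j` — the open mesh square `(δk, δ(k+1)) × (δj, δ(j+1))` (Mathlib's `reProdIm` of two
  open intervals) with centre `cellCenter δ k j`; cells are open, convex, miss the grid lines, and
  their closures are the closed squares (`closure_cell`). This is the same set as the tree's
  `Complex.gridOpenSquare δ (k, j)` of `Analysis/Complex/GridCauchyFormula.lean` (written there
  with `k * δ`; bridging lemmas `cell_eq_gridOpenSquare`, `closure_cell_eq_gridSquare`), kept as a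
  curried `δ * k` definition because every computation below is in that normal form.
* `corner k j a b` — the four corner sites `(k + a, j + b)`, `a b : Bool`; this is the `Bool²`
  re-indexing of the face corners `cornerOff` of `MedialInterfaceProofs.lean` (faces indexed by
  their lower-left site `![k, j]`), and `cellCenter δ k j = δ • faceCenter ![k, j]` of
  `FermionicObservable.lean`; neither file is imported here (heavy), the identities are recorded
  for bridging only.
* `rung k j` — the horizontal lattice edge `{(k, j), (k+1, j)}` of *column* `k`; `IsKRung k e`.
* **Crossing parity** (`even_kRungCount_iff`): along any lattice walk, the number of traversed
  rungs of column `k` is even iff the two end-points lie on the same side of the vertical line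
  `re z = δ(k + ½)` (each lattice step changes side exactly when it is a rung of column `k`).

All statements are folklore lattice geometry; nothing here is specific to percolation. The
declarations live in the sub-namespace `Literature.Probability.LatticeModels.Mesh` (the bare names
`cell`, `corner`, `rung` would otherwise sit next to the unrelated `meshCell` — a closed square
centred at a site — and the medial `corner…` vocabulary of this directory).
Mathlib anchors: `Complex.reProdIm` (`×ℂ`), `closure_reProdIm`, `segment`, `Convex`,
`SimpleGraph.Walk.edges`, `List.countP`. H21 anchors: `Site`, `zdGraph`, `meshPoint`,
`meshVertices` (`LatticeGraph.lean`, `DomainDiscretisation.lean`), `Complex.gridOpenSquare`,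
`Complex.gridSquare` (`Analysis/Complex/GridCauchyFormula.lean`).
-/

namespace Literature.Probability.LatticeModels.Mesh

open Set Complex

noncomputable section

/-! ### Grid lines and mesh points -/

/-- The grid lines of the mesh `δℤ²`: points with a coordinate in `δℤ`. [folklore] -/
def gridLines (δ : ℝ) : Set ℂ :=
  {z | (∃ n : ℤ, z.re = δ * n) ∨ ∃ n : ℤ, z.im = δ * n}

/-- Mesh points lie on the grid lines. [folklore] -/
theorem meshPoint_mem_gridLines (δ : ℝ) (x : Site 2) : meshPoint δ x ∈ gridLines δ :=
  Or.inl ⟨x 0, meshPoint_re δ x⟩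

/-- A lattice step changes one coordinate by `±1` and keeps the other. [folklore] -/
theorem exists_coord_eq_of_adj {x y : Site 2} (h : (zdGraph 2).Adj x y) :
    ∃ i : Fin 2, (y i = x i + 1 ∨ x i = y i + 1) ∧ ∀ l, l ≠ i → y l = x l := by
  obtain ⟨i, h | h⟩ := (zdGraph_adj_iff x y).1 h
  · refine ⟨i, Or.inl (by rw [h]; simp), fun l hl => ?_⟩
    rw [h]; simp [hl]
  · refine ⟨i, Or.inr (by rw [h]; simp), fun l hl => ?_⟩
    rw [h]; simp [hl]

/-- A closed mesh edge lies on the grid lines. [folklore] -/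
theorem segment_meshPoint_subset_gridLines (δ : ℝ) {x y : Site 2} (h : (zdGraph 2).Adj x y) :
    segment ℝ (meshPoint δ x) (meshPoint δ y) ⊆ gridLines δ := by
  obtain ⟨i, -, hl⟩ := exists_coord_eq_of_adj h
  intro z hz
  obtain ⟨a, b, -, -, hab, rfl⟩ := hz
  fin_cases i
  · -- horizontal step: the second coordinate is constant
    right
    refine ⟨x 1, ?_⟩
    have h1 : y 1 = x 1 := hl 1 (by decide)
    simp only [add_im, smul_im, meshPoint_im, h1, smul_eq_mul]
    rw [← add_mul, hab, one_mul]
  · left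
    refine ⟨x 0, ?_⟩
    have h0 : y 0 = x 0 := hl 0 (by decide)
    simp only [add_re, smul_re, meshPoint_re, h0, smul_eq_mul]
    rw [← add_mul, hab, one_mul]

/-- Two sites of `ℤ²` with the same two coordinates are equal (local copy of a helper that
also exists in `Percolation/DualContours.lean`, kept private to avoid the import). [folklore] -/
private theorem site2_ext {v w : Site 2} (h0 : v 0 = w 0) (h1 : v 1 = w 1) : v = w := by
  funext l; fin_cases l <;> assumption

/-- **A mesh point on a closed mesh edge is one of its ends.** [folklore] -/
theorem eq_or_eq_of_meshPoint_mem_segment {δ : ℝ} (hδ : 0 < δ) {x y v : Site 2}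
    (h : (zdGraph 2).Adj x y) (hv : meshPoint δ v ∈ segment ℝ (meshPoint δ x) (meshPoint δ y)) :
    v = x ∨ v = y := by
  obtain ⟨i, hi, hl⟩ := exists_coord_eq_of_adj h
  obtain ⟨a, b, ha, hb, hab, hv⟩ := hv
  have hre := congrArg Complex.re hv
  have him := congrArg Complex.im hv
  simp only [add_re, smul_re, meshPoint_re, add_im, smul_im, meshPoint_im, smul_eq_mul] at hre him
  -- coordinates of `v` as convex combinations
  have hc : ∀ l : Fin 2, a * (x l : ℝ) + b * (y l : ℝ) = v l := by
    intro l
    fin_cases l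
    · have : δ * (a * (x 0 : ℝ) + b * (y 0 : ℝ)) = δ * (v 0 : ℝ) := by rw [← hre]; ring
      exact mul_left_cancel₀ hδ.ne' this
    · have : δ * (a * (x 1 : ℝ) + b * (y 1 : ℝ)) = δ * (v 1 : ℝ) := by rw [← him]; ring
      exact mul_left_cancel₀ hδ.ne' this
  -- the constant coordinate
  have hconst : ∀ l, l ≠ i → v l = x l := by
    intro l hli
    have := hc l
    rw [hl l hli, ← add_mul, hab, one_mul] at this
    exact_mod_cast this.symm
  -- the moving coordinate: `v i` is an integer in `[x i, y i]` (length one), so an endpoint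
  have hvi : v i = x i ∨ v i = y i := by
    have key := hc i
    have ha0 : (0 : ℝ) ≤ a := ha
    have hb0 : (0 : ℝ) ≤ b := hb
    rcases hi with hy | hx
    · have hyr : (y i : ℝ) = x i + 1 := by exact_mod_cast hy
      have h1 : (v i : ℝ) = x i + b := by rw [← key, hyr]; linear_combination (x i : ℝ) * hab
      have hlo : x i ≤ v i := by exact_mod_cast (by linarith : (x i : ℝ) ≤ v i)
      have hhi : v i ≤ x i + 1 := by exact_mod_cast (by linarith : (v i : ℝ) ≤ x i + 1)
      omega
    · have hxr : (x i : ℝ) = y i + 1 := by exact_mod_cast hx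
      have h1 : (v i : ℝ) = y i + a := by rw [← key, hxr]; linear_combination (y i : ℝ) * hab
      have hlo : y i ≤ v i := by exact_mod_cast (by linarith : (y i : ℝ) ≤ v i)
      have hhi : v i ≤ y i + 1 := by exact_mod_cast (by linarith : (v i : ℝ) ≤ y i + 1)
      omega
  rcases hvi with hvi | hvi
  · left
    funext l
    by_cases hli : l = i
    · rw [hli, hvi]
    · exact hconst l hli
  · right
    funext l
    by_cases hli : l = i
    · rw [hli, hvi]
    · rw [hconst l hli, hl l hli]

/-! ### Cells -/

/-- The open mesh cell with lower-left corner `δ (k, j)`: `(δk, δ(k+1)) × (δj, δ(j+1))`. Equal to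
`Complex.gridOpenSquare δ (k, j)` (`cell_eq_gridOpenSquare`); kept curried and in the `δ * k`
normal form used throughout this file. [folklore] -/
def cell (δ : ℝ) (k j : ℤ) : Set ℂ :=
  Ioo (δ * k) (δ * (k + 1)) ×ℂ Ioo (δ * j) (δ * (j + 1))

/-- Bridge to the grid squares of `GridCauchyFormula.lean`: the cell is `Complex.gridOpenSquare`.
[folklore] -/
theorem cell_eq_gridOpenSquare (δ : ℝ) (k j : ℤ) : cell δ k j = Complex.gridOpenSquare δ (k, j) := by
  simp only [cell, Complex.gridOpenSquare, mul_comm δ]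

/-- The centre of the cell `(k, j)` (equal to `δ • faceCenter ![k, j]` of
`FermionicObservable.lean`, not imported). [folklore] -/
def cellCenter (δ : ℝ) (k j : ℤ) : ℂ := ⟨δ * (k + 1 / 2), δ * (j + 1 / 2)⟩

/-- Real and imaginary parts of the cell centre. [folklore] -/
@[simp] theorem cellCenter_re (δ : ℝ) (k j : ℤ) : (cellCenter δ k j).re = δ * (k + 1 / 2) := rfl

/-- Real and imaginary parts of the cell centre. [folklore] -/
@[simp] theorem cellCenter_im (δ : ℝ) (k j : ℤ) : (cellCenter δ k j).im = δ * (j + 1 / 2) := rfl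

/-- Membership in a cell, in coordinates. [folklore] -/
theorem mem_cell_iff {δ : ℝ} {k j : ℤ} {z : ℂ} :
    z ∈ cell δ k j ↔ (δ * k < z.re ∧ z.re < δ * (k + 1)) ∧ δ * j < z.im ∧ z.im < δ * (j + 1) :=
  Iff.rfl

/-- Cells are open. [folklore] -/
theorem isOpen_cell (δ : ℝ) (k j : ℤ) : IsOpen (cell δ k j) :=
  isOpen_Ioo.reProdIm isOpen_Ioo

/-- Cells are convex. [folklore] -/
theorem convex_cell (δ : ℝ) (k j : ℤ) : Convex ℝ (cell δ k j) := by
  have : convexHull ℝ (cell δ k j) = cell δ k j := by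
    rw [cell, convexHull_reProdIm, (convex_Ioo _ _).convexHull_eq, (convex_Ioo _ _).convexHull_eq]
  rw [← this]; exact convex_convexHull ℝ _

/-- The centre lies in its cell (`δ > 0`). [folklore] -/
theorem cellCenter_mem_cell {δ : ℝ} (hδ : 0 < δ) (k j : ℤ) : cellCenter δ k j ∈ cell δ k j := by
  refine ⟨⟨?_, ?_⟩, ?_, ?_⟩ <;> simp only [cellCenter_re, cellCenter_im] <;> nlinarith

/-- The closure of a cell is the closed square (`δ > 0`). [folklore] -/
theorem closure_cell {δ : ℝ} (hδ : 0 < δ) (k j : ℤ) :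
    closure (cell δ k j) = Icc (δ * k) (δ * (k + 1)) ×ℂ Icc (δ * j) (δ * (j + 1)) := by
  have h1 : δ * k < δ * (k + 1) := by nlinarith
  have h2 : δ * j < δ * (j + 1) := by nlinarith
  rw [cell, closure_reProdIm, closure_Ioo h1.ne, closure_Ioo h2.ne]

/-- Bridge: the closure of a cell is the closed grid square `Complex.gridSquare` of
`GridCauchyFormula.lean` (`δ > 0`). [folklore] -/
theorem closure_cell_eq_gridSquare {δ : ℝ} (hδ : 0 < δ) (k j : ℤ) :
    closure (cell δ k j) = Complex.gridSquare δ (k, j) := by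
  rw [closure_cell hδ]
  simp only [Complex.gridSquare, mul_comm δ]

/-- A strictly-between real is not an integer multiple: if `δ n < t < δ (n+1)` then `t ∉ δℤ`.
[folklore] -/
theorem ne_mul_int_of_mem_Ioo {δ : ℝ} (hδ : 0 < δ) {n : ℤ} {t : ℝ} (ht : t ∈ Ioo (δ * n) (δ * (n + 1)))
    (m : ℤ) : t ≠ δ * m := by
  rintro rfl
  obtain ⟨h1, h2⟩ := ht
  have h1' : (n : ℝ) < m := lt_of_mul_lt_mul_left h1 hδ.le
  have h2' : (m : ℝ) < n + 1 := lt_of_mul_lt_mul_left h2 hδ.le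
  have : n < m := by exact_mod_cast h1'
  have : m < n + 1 := by exact_mod_cast h2'
  omega

/-- Cells miss the grid lines (`δ > 0`). [folklore] -/
theorem cell_subset_compl_gridLines {δ : ℝ} (hδ : 0 < δ) (k j : ℤ) :
    cell δ k j ⊆ (gridLines δ)ᶜ := by
  rintro z ⟨hre, him⟩ (⟨n, hn⟩ | ⟨n, hn⟩)
  · exact ne_mul_int_of_mem_Ioo hδ hre n hn
  · exact ne_mul_int_of_mem_Ioo hδ him n hn

/-- Mesh points are not in (open) cells. [folklore] -/
theorem meshPoint_not_mem_cell {δ : ℝ} (hδ : 0 < δ) (x : Site 2) (k j : ℤ) :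
    meshPoint δ x ∉ cell δ k j := fun h =>
  cell_subset_compl_gridLines hδ k j h (meshPoint_mem_gridLines δ x)

/-- The four corner sites of the cell `(k, j)`: `(k + a, j + b)` for `a, b ∈ {0, 1}`, encoded by
`Bool`s (the `Bool²` re-indexing of `cornerOff` of `MedialInterfaceProofs.lean`, faces being
indexed there by the lower-left site `![k, j]`; not imported). [folklore] -/
def corner (k j : ℤ) (a b : Bool) : Site 2 := ![k + (if a then 1 else 0), j + (if b then 1 else 0)]

/-- Coordinates of a corner. [folklore] -/
@[simp] theorem corner_zero (k j : ℤ) (a b : Bool) : corner k j a b 0 = k + (if a then 1 else 0) := rfl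

/-- Coordinates of a corner. [folklore] -/
@[simp] theorem corner_one (k j : ℤ) (a b : Bool) : corner k j a b 1 = j + (if b then 1 else 0) := rfl

/-- The `0/1` offset of a corner, as a real number, lies in `[0, 1]`. [folklore] -/
theorem ite_cast_mem_unit (a : Bool) :
    (0 : ℝ) ≤ ((if a then 1 else 0 : ℤ) : ℝ) ∧ ((if a then 1 else 0 : ℤ) : ℝ) ≤ 1 := by
  cases a <;> simp

/-- The corners of a cell lie in its closure (`δ > 0`). [folklore] -/
theorem meshPoint_corner_mem_closure_cell {δ : ℝ} (hδ : 0 < δ) (k j : ℤ) (a b : Bool) :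
    meshPoint δ (corner k j a b) ∈ closure (cell δ k j) := by
  rw [closure_cell hδ]
  have ha := ite_cast_mem_unit a
  have hb := ite_cast_mem_unit b
  refine ⟨⟨?_, ?_⟩, ?_, ?_⟩ <;>
    simp only [meshPoint_re, meshPoint_im, corner_zero, corner_one, Int.cast_add] <;> nlinarith

/-- A closed segment between two corners of a cell lies in the closure of the cell (convexity of
the closed square). [folklore] -/
theorem segment_corner_subset_closure_cell {δ : ℝ} (hδ : 0 < δ) (k j : ℤ) (a b a' b' : Bool) :
    segment ℝ (meshPoint δ (corner k j a b)) (meshPoint δ (corner k j a' b')) ⊆ closure (cell δ k j) :=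
  (convex_cell δ k j).closure.segment_subset (meshPoint_corner_mem_closure_cell hδ k j a b)
    (meshPoint_corner_mem_closure_cell hδ k j a' b')

/-- Horizontal neighbours among the corners are lattice neighbours. [folklore] -/
theorem zdGraph_adj_corner_horizontal (k j : ℤ) (b : Bool) :
    (zdGraph 2).Adj (corner k j false b) (corner k j true b) := by
  rw [zdGraph_adj_iff]
  refine ⟨0, Or.inl ?_⟩
  funext l; fin_cases l <;> simp [corner]

/-- Vertical neighbours among the corners are lattice neighbours. [folklore] -/
theorem zdGraph_adj_corner_vertical (k j : ℤ) (a : Bool) :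
    (zdGraph 2).Adj (corner k j a false) (corner k j a true) := by
  rw [zdGraph_adj_iff]
  refine ⟨1, Or.inl ?_⟩
  funext l; fin_cases l <;> simp [corner]

/-- The top corners of cell `(k, j)` are the bottom corners of cell `(k, j + 1)`. [folklore] -/
theorem corner_top_eq (k j : ℤ) (a : Bool) : corner k j a true = corner k (j + 1) a false := by
  funext l; fin_cases l <;> simp [corner]

/-! ### Rungs of a column and the crossing parity -/

/-- The horizontal lattice edge `{(k, j), (k+1, j)}` — a *rung* of column `k`. [folklore] -/
def rung (k j : ℤ) : Sym2 (Site 2) := s(corner k j false false, corner k j true false)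

/-- `e` is a rung of column `k`. [folklore] -/
def IsKRung (k : ℤ) (e : Sym2 (Site 2)) : Prop := ∃ j, e = rung k j

/-- A lattice step is a rung of column `k` exactly when it changes side with respect to the
vertical line between columns `k` and `k + 1`. [folklore] -/
theorem isKRung_iff_side_ne (k : ℤ) {x y : Site 2} (h : (zdGraph 2).Adj x y) :
    IsKRung k s(x, y) ↔ ¬ (x 0 ≤ k ↔ y 0 ≤ k) := by
  obtain ⟨i, hi, hl⟩ := exists_coord_eq_of_adj h
  constructor
  · rintro ⟨j, hj⟩
    rw [rung, Sym2.eq_iff] at hj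
    rcases hj with ⟨rfl, rfl⟩ | ⟨rfl, rfl⟩ <;> simp
  · intro hne
    fin_cases i
    · -- horizontal step
      have h1 : y 1 = x 1 := hl 1 (by decide)
      rcases hi with hy | hx
      · -- `y 0 = x 0 + 1`: side changes iff `x 0 = k`
        have hy' : y 0 = x 0 + 1 := hy
        have hx0 : x 0 = k := by
          by_contra hne'
          apply hne
          constructor
          · intro hxk; omega
          · intro hyk; omega
        have hy0 : y 0 = k + 1 := by omega
        refine ⟨x 1, ?_⟩
        rw [rung, Sym2.eq_iff]
        left
        constructor
        · exact site2_ext (by simp [hx0]) (by simp)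
        · exact site2_ext (by simp [hy0]) (by simp [h1])
      · have hx' : x 0 = y 0 + 1 := hx
        have hy0 : y 0 = k := by
          by_contra hne'
          apply hne
          constructor
          · intro hxk; omega
          · intro hyk; omega
        have hx0 : x 0 = k + 1 := by omega
        refine ⟨x 1, ?_⟩
        rw [rung, Sym2.eq_iff]
        right
        constructor
        · exact site2_ext (by simp [hx0]) (by simp)
        · exact site2_ext (by simp [hy0]) (by simp [h1])
    · -- vertical step: no side change
      exfalso
      apply hne
      have h0 : y 0 = x 0 := hl 0 (by decide)
      rw [h0]

open Classical in
/-- The number of rungs of column `k` traversed by a lattice walk (with multiplicity). [folklore] -/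
def kRungCount (k : ℤ) {u v : Site 2} (W : (zdGraph 2).Walk u v) : ℕ :=
  W.edges.countP fun e => decide (IsKRung k e)

/-- `kRungCount` of the empty walk. [folklore] -/
@[simp] theorem kRungCount_nil (k : ℤ) (u : Site 2) :
    kRungCount k (SimpleGraph.Walk.nil : (zdGraph 2).Walk u u) = 0 := by
  simp [kRungCount]

open Classical in
/-- `kRungCount` of a walk with a first step. [folklore] -/
theorem kRungCount_cons (k : ℤ) {u v w : Site 2} (h : (zdGraph 2).Adj u v) (W : (zdGraph 2).Walk v w) :
    kRungCount k (SimpleGraph.Walk.cons h W) =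
      kRungCount k W + (if IsKRung k s(u, v) then 1 else 0) := by
  unfold kRungCount
  rw [SimpleGraph.Walk.edges_cons, List.countP_cons]
  by_cases hr : IsKRung k s(u, v) <;> simp [hr]

/-- **Crossing parity.** Along a lattice walk from `u` to `v`, the number of traversed rungs of
column `k` is even iff `u` and `v` lie on the same side of the vertical line separating columns
`k` and `k + 1`. [folklore] -/
theorem even_kRungCount_iff (k : ℤ) {u v : Site 2} (W : (zdGraph 2).Walk u v) :
    Even (kRungCount k W) ↔ (u 0 ≤ k ↔ v 0 ≤ k) := by
  induction W with
  | nil => simp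
  | @cons a b c h W ih =>
    rw [kRungCount_cons]
    by_cases hr : IsKRung k s(a, b)
    · rw [if_pos hr, Nat.even_add_one, ih]
      have := (isKRung_iff_side_ne k h).1 hr
      tauto
    · rw [if_neg hr, add_zero, ih]
      have := (isKRung_iff_side_ne k h).not.1 hr
      push Not at this
      tauto

/-- In particular, a walk from the left of the line to its right traverses an odd number of rungs
of column `k`. [folklore] -/
theorem odd_kRungCount (k : ℤ) {u v : Site 2} (W : (zdGraph 2).Walk u v) (hu : u 0 ≤ k)
    (hv : k + 1 ≤ v 0) : Odd (kRungCount k W) := by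
  rw [← Nat.not_even_iff_odd, even_kRungCount_iff]
  intro h
  have := h.1 hu
  omega

end

end Literature.Probability.LatticeModels.Mesh
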